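import Summits.ResolutionOfSingularities.ResolutionOfSingularities.Theorems.MaxContactCutPinchTower
import Literature.AlgebraicGeometry.Resolution.OrderSemicontinuityPointwise
import Literature.AlgebraicGeometry.Resolution.AdicCompletionRegular

/-!
# ShallowCutAlg — ring-level algebra for the cone-shallow exit (slice 1/4 of the node «ShallowCut»)

`decomp-res-lens-2`, generation 32 (RESIDUAL MODE node; critic row 228 standing).  Engine letter (C)
`PinchCut.FlatConeExit` (Theorems/PinchCutClasses.lean), proved in slice 4/4 `MaxContactCutShallowCut`.

* §1 `eval₂_mul_smul_of_degree_eq` — a form all of whose monomials have degree `n` scales: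
  `Φ(t·e) = tⁿ·Φ(e)`;  `eval₂_mem_of_coeff_mem` — a polynomial whose coefficients map into an ideal evaluates into it.
* §2 (`x/1 ∈ 𝔪ⁿ` in the localisation at a prime `Q` gives `s·x ∈ Qⁿ` for some `s ∉ Q`, no domain hypothesis,
  is the tree's `OrderSemicontinuity.exists_mul_mem_pow_of_algebraMap_mem_maximalIdeal_pow_general`
  [Theorems/WeightedInvariantOrderSemicontinuousSmooth] — cited, not restated (gate `dedup.landed`; writer deviation));
  `mem_pow_of_mul_mem_pow_of_le` — ZARISKI–NAGATA INSIDE A REGULAR RING: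
  `s·x ∈ 𝔔ⁿ`, `s ∉ 𝔔`, `𝔔 ⊆ 𝔑` maximal ⇒ `x ∈ 𝔑ⁿ` (Literature `mem_pow_of_mul_mem_pow` in `T_𝔑`).
* §3 `coneShallow_rename` — transport of the letter's `ConeShallow` along the RENAME EQUIVALENCE
  `MvPolynomial (Fin d) ≅ MvPolynomial {i : Fin (d+1) // i ≠ j'.succ}` (`j' ↦ 0`, `i' ↦ i'.succ`): the phantom
  variable `U_{j'}` of `dehomog j'` plays the rôle of the exceptional coordinate `Z' = T₀` of the `u_{j'}`-chart.

Sources: [Hironaka1964] Ch. III §1 (`𝔭⁽ⁿ⁾ ⊆ 𝔪ⁿ`); [Matsumura1987] Thm. 19.3; [CossartJannsenSaito2020] Ch. 2.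
-/

open IsLocalRing
open Literature.AlgebraicGeometry.Resolution

namespace Summit.ResolutionOfSingularities.ResolutionOfSingularities.Theorems.ShallowCut

/-! ## §1  Homogeneous forms: scaling and evaluation into an ideal -/

/-- **Scaling of a form of pure degree `n`**: `Φ(t·e) = tⁿ·Φ(e)`. [folklore] -/
theorem eval₂_mul_smul_of_degree_eq {R S : Type} [CommRing R] [CommRing S] {d n : ℕ} (σ : R →+* S)
    (Φ : MvPolynomial (Fin d) R) (hΦ : ∀ m ∈ Φ.support, Finsupp.degree m = n) (t : S) (e : Fin d → S) :
    MvPolynomial.eval₂ σ (fun i => t * e i) Φ = t ^ n * MvPolynomial.eval₂ σ e Φ := by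
  classical
  rw [MvPolynomial.eval₂_eq, MvPolynomial.eval₂_eq, Finset.mul_sum]
  refine Finset.sum_congr rfl fun m hm => ?_
  have hprod : (∏ i ∈ m.support, (t * e i) ^ m i) = t ^ n * ∏ i ∈ m.support, e i ^ m i := by
    rw [Finset.prod_congr rfl fun i _ => mul_pow t (e i) (m i), Finset.prod_mul_distrib,
      Finset.prod_pow_eq_pow_sum, ← Finsupp.degree_apply, hΦ m hm]
  rw [hprod]
  ring

/-- **A polynomial whose coefficients map into an ideal evaluates into that ideal.** [folklore] -/
theorem eval₂_mem_of_coeff_mem {R S : Type} [CommRing R] [CommRing S] {d : ℕ} (σ : R →+* S)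
    (Φ : MvPolynomial (Fin d) R) (J : Ideal S) (hΦ : ∀ m ∈ Φ.support, σ (Φ.coeff m) ∈ J) (e : Fin d → S) :
    MvPolynomial.eval₂ σ e Φ ∈ J := by
  classical
  rw [MvPolynomial.eval₂_eq]
  exact J.sum_mem fun m hm => J.mul_mem_right _ (hΦ m hm)

/-! ## §2  Powers of primes under localisation; Zariski–Nagata inside a regular ring -/

/-- **In a maximal ideal's power, a cofactor outside the ideal can be cancelled**: `s ∉ 𝔑` maximal and
`s·x ∈ 𝔑ⁿ` give `x ∈ 𝔑ⁿ` (`(s) + 𝔑ⁿ = (1)`). [folklore] -/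
theorem mem_pow_of_mul_mem_pow_of_isMaximal {T : Type*} [CommRing T] (𝔑 : Ideal T) [𝔑.IsMaximal] {n : ℕ}
    {x s : T} (hs : s ∉ 𝔑) (hsx : s * x ∈ 𝔑 ^ n) : x ∈ 𝔑 ^ n := by
  have htop : Ideal.span {s} ⊔ 𝔑 = ⊤ := by
    refine (‹𝔑.IsMaximal›.out.2 _ ?_)
    refine lt_of_le_of_ne le_sup_right fun h => hs ?_
    rw [h]; exact Ideal.mem_sup_left (Ideal.mem_span_singleton_self s)
  have htop' : Ideal.span {s} ⊔ 𝔑 ^ n = ⊤ := Ideal.sup_pow_eq_top htop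
  obtain ⟨a, ha, b, hb, hab⟩ := Submodule.mem_sup.mp ((Ideal.eq_top_iff_one _).mp htop')
  obtain ⟨r, rfl⟩ := Ideal.mem_span_singleton'.mp ha
  have : x = r * (s * x) + x * b := by
    calc x = x * (r * s + b) := by rw [hab, mul_one]
      _ = r * (s * x) + x * b := by ring
  rw [this]
  exact (𝔑 ^ n).add_mem ((𝔑 ^ n).mul_mem_left _ hsx) ((𝔑 ^ n).mul_mem_left _ hb)

/-- **ZARISKI–NAGATA INSIDE A REGULAR RING**: in a regular ring `T`, for primes `𝔔 ⊆ 𝔑` with `𝔑` maximal,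
`s·x ∈ 𝔔ⁿ` with `s ∉ 𝔔` forces `x ∈ 𝔑ⁿ` — the symbolic power `𝔔⁽ⁿ⁾` lies in `𝔑ⁿ` (Literature
`mem_pow_of_mul_mem_pow` in the regular local ring `T_𝔑`, then `§2` above).
[cite: Matsumura1987, Thm. 19.3] -/
theorem mem_pow_of_mul_mem_pow_of_le {T : Type} [CommRing T] [IsRegularRing T] {𝔔 𝔑 : Ideal T}
    [𝔔.IsPrime] [𝔑.IsMaximal] (hle : 𝔔 ≤ 𝔑) {n : ℕ} {x s : T} (hs : s ∉ 𝔔) (hsx : s * x ∈ 𝔔 ^ n) :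
    x ∈ 𝔑 ^ n := by
  haveI : IsRegularLocalRing (Localization.AtPrime 𝔑) := inferInstance
  set L := Localization.AtPrime 𝔑
  haveI h𝔔L : (𝔔.map (algebraMap T L)).IsPrime :=
    IsLocalization.isPrime_of_isPrime_disjoint 𝔑.primeCompl L 𝔔 ‹_› (disjoint_primeCompl_of_le hle)
  have hcomap : (𝔔.map (algebraMap T L)).comap (algebraMap T L) = 𝔔 := by
    rw [← Ideal.under_def]
    exact IsLocalization.under_map_of_isPrime_disjoint 𝔑.primeCompl L ‹_› (disjoint_primeCompl_of_le hle)
  have hsL : algebraMap T L s ∉ 𝔔.map (algebraMap T L) := fun h => hs (by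
    rw [← hcomap]; exact Ideal.mem_comap.mpr h)
  have hsxL : algebraMap T L s * algebraMap T L x ∈ 𝔔.map (algebraMap T L) ^ n := by
    rw [← map_mul, ← Ideal.map_pow]
    exact Ideal.mem_map_of_mem _ hsx
  have hxL : algebraMap T L x ∈ maximalIdeal L ^ n := mem_pow_of_mul_mem_pow (𝔔.map (algebraMap T L)) hsL hsxL
  obtain ⟨s', hs', hs'x⟩ :=
    OrderSemicontinuity.exists_mul_mem_pow_of_algebraMap_mem_maximalIdeal_pow_general 𝔑 L hxL
  exact mem_pow_of_mul_mem_pow_of_isMaximal 𝔑 hs' hs'x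

/-! ## §3  Transport of `ConeShallow` along the rename equivalence (the phantom variable becomes `Z'`) -/

section Rename

open MvPolynomial
open Summit.ResolutionOfSingularities.ResolutionOfSingularities.Theorems.PinchCut

variable {d : ℕ}

/-- The re-indexing `Fin d → {i : Fin (d+1) // i ≠ j'.succ}`: `j' ↦ 0`, `i' ↦ i'.succ` otherwise. [folklore] -/
def coneIndex (j' : Fin d) (i : Fin d) : {i : Fin (d + 1) // i ≠ j'.succ} :=
  if h : i = j' then ⟨0, fun h0 => Fin.succ_ne_zero j' h0.symm⟩
  else ⟨i.succ, fun hs => h (Fin.succ_injective _ hs)⟩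

/-- `coneIndex j'` is a bijection. [folklore] -/
theorem coneIndex_bijective (j' : Fin d) : Function.Bijective (coneIndex j') := by
  classical
  rw [Fintype.bijective_iff_injective_and_card]
  refine ⟨fun a b hab => ?_, by simp [Fintype.card_subtype_compl]⟩
  unfold coneIndex at hab
  by_cases ha : a = j' <;> by_cases hb : b = j'
  · rw [ha, hb]
  · rw [dif_pos ha, dif_neg hb] at hab
    exact absurd (congrArg Subtype.val hab) (Fin.succ_ne_zero b).symm
  · rw [dif_neg ha, dif_pos hb] at hab
    exact absurd (congrArg Subtype.val hab) (Fin.succ_ne_zero a)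
  · rw [dif_neg ha, dif_neg hb] at hab
    exact Fin.succ_injective _ (congrArg Subtype.val hab)

/-- The rename equivalence `θ : (R/𝔭)[U₀, …, U_{d-1}] ≅ (R/𝔭)[T_i : i ≠ j'.succ]` along `coneIndex j'`. [folklore] -/
noncomputable def coneRename (S : Type) [CommRing S] (j' : Fin d) :
    MvPolynomial (Fin d) S ≃+* MvPolynomial {i : Fin (d + 1) // i ≠ j'.succ} S :=
  (MvPolynomial.renameEquiv S (Equiv.ofBijective (coneIndex j') (coneIndex_bijective j'))).toRingEquiv

/-- `coneRename` is `rename (coneIndex j')`. [folklore] -/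
theorem coneRename_apply (S : Type) [CommRing S] (j' : Fin d) (p : MvPolynomial (Fin d) S) :
    coneRename S j' p = MvPolynomial.rename (coneIndex j') p := rfl

/-- **The chart-`j'` substitution** `U_i ↦ T_{i.succ}` (`i ≠ j'`), `U_{j'} ↦ 1`, for polynomials over any `S`.
[folklore] -/
noncomputable def coneSubst (S : Type) [CommRing S] (j' : Fin d) (i : Fin d) :
    MvPolynomial {i : Fin (d + 1) // i ≠ j'.succ} S :=
  if h : i.succ = j'.succ then 1 else MvPolynomial.X ⟨i.succ, h⟩

/-- **`θ (dehomog j' Q) = Q(U_i ↦ T_{i.succ}, U_{j'} ↦ 1)`**: along the rename equivalence the chart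
dehomogenisation becomes the chart substitution. [folklore] -/
theorem coneRename_dehomog (S : Type) [CommRing S] (j' : Fin d) (Q : MvPolynomial (Fin d) S) :
    coneRename S j' (dehomog j' Q) = MvPolynomial.aeval (coneSubst S j') Q := by
  rw [coneRename_apply, dehomog, ← AlgHom.comp_apply, MvPolynomial.comp_aeval]
  have hfun : (fun i : Fin d => (MvPolynomial.rename (coneIndex j'))
      (if i = j' then (1 : MvPolynomial (Fin d) S) else MvPolynomial.X i)) = coneSubst S j' := by
    funext i
    unfold coneSubst coneIndex
    by_cases h : i = j'
    · subst h
      rw [if_pos rfl, dif_pos rfl, map_one]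
    · rw [if_neg h, MvPolynomial.rename_X, dif_neg h, dif_neg (fun hs => h (Fin.succ_injective _ hs))]
  rw [hfun]

/-- **TRANSPORT OF `ConeShallow`**: for a cone-shallow form, in the chart ring `(R/𝔭)[T_i : i ≠ j'.succ]` NO maximal
ideal containing `v̄` and the exceptional coordinate `T₀` contains `Φ̄(U_i ↦ T_{i.succ}, U_{j'} ↦ 1)` in its `n`-th
power (pull the maximal ideal back along `θ`; `θ (C v̄) = C v̄`, `θ (U_{j'}) = T₀`). [folklore] -/
theorem coneShallow_rename {R : Type} [CommRing R] (P : Ideal R) (v : R) (Φ : MvPolynomial (Fin d) R) {n : ℕ}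
    (hcs : ConeShallow P v Φ n) (j' : Fin d)
    (N' : Ideal (MvPolynomial {i : Fin (d + 1) // i ≠ j'.succ} (R ⧸ P))) [N'.IsMaximal]
    (hv : MvPolynomial.C (Ideal.Quotient.mk P v) ∈ N')
    (h0 : (MvPolynomial.X ⟨0, fun h0 => Fin.succ_ne_zero j' h0.symm⟩ :
      MvPolynomial {i : Fin (d + 1) // i ≠ j'.succ} (R ⧸ P)) ∈ N') :
    MvPolynomial.aeval (coneSubst (R ⧸ P) j') (MvPolynomial.map (Ideal.Quotient.mk P) Φ) ∉ N' ^ n := by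
  intro hmem
  set θ := coneRename (R ⧸ P) j' with hθ
  have hN : (N'.comap θ).IsMaximal := Ideal.comap_isMaximal_of_surjective _ θ.surjective
  refine hcs j' (N'.comap θ) hN ?_ ?_ ?_
  · rw [Ideal.mem_comap, hθ, coneRename_apply, MvPolynomial.rename_C]
    exact hv
  · rw [Ideal.mem_comap, hθ, coneRename_apply, MvPolynomial.rename_X]
    unfold coneIndex
    rw [dif_pos rfl]
    exact h0
  · have hpow : (N'.comap θ) ^ n = (N' ^ n).comap θ := by
      rw [← Ideal.map_symm, ← Ideal.map_symm, Ideal.map_pow]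
    rw [hpow, Ideal.mem_comap, hθ, coneRename_dehomog]
    exact hmem

end Rename

end Summit.ResolutionOfSingularities.ResolutionOfSingularities.Theorems.ShallowCut
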